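import Mathlib.RepresentationTheory.Coinvariants
import Mathlib.RepresentationTheory.Invariants
import Mathlib.LinearAlgebra.Trace
import Mathlib.GroupTheory.OrderOfElement
import HarnessLib

/-!
# An involution inverting an odd-order group has trace zero on the augmentation submodule
# (atom A6 of the `G`-signature bookkeeping for `[W_0]² = Sign(ι, X)`; cell `hodge-kum4`, seat p2)

HONEST FRAMING.  Pure linear algebra, PROVED; no named fact; nothing about the Hodge conjecture.

Let `k` be a field, `G` a finite group of ODD order invertible in `k`, `ρ : G → GL(V)` a
representation (finite-dimensional or not: Mathlib's trace is `0` off finite free modules and the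
argument is insensitive to that), and `ι : V → V` a linear map with `ι ∘ ρ(g) = ρ(g⁻¹) ∘ ι` for
all `g` (e.g. an involution normalising `G` and inverting it: `Aut₀(X) = Γ ⋊ ⟨ι⟩` for `Kumⁿ`-type,
`ι g ι = g⁻¹`).  Then `ι` preserves the augmentation submodule `𝒦(ρ) = span{ρ(g)v − v}`
(`coinvariantsKer_mapsTo_of_conj`) and

  `tr(ι | 𝒦(ρ)) = 0`   (`trace_restrict_coinvariantsKer_eq_zero`).

Character-free proof: `ρ(h²) ∘ ι = ρ(h) ∘ ι ∘ ρ(h)⁻¹` is conjugate to `ι` on `𝒦`, so has the same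
trace there; `h ↦ h²` is a bijection of `G` (odd order, Mathlib `Nat.Coprime.pow_left_bijective`), so
summing over `h` gives `|G| · tr(ι|𝒦) = tr((Σ_g ρ(g)) ∘ ι |𝒦) = 0`, because `Σ_g ρ(g)` kills `𝒦`
(`sum_apply_eq_zero_of_mem_coinvariantsKer`).  (Over `ℂ` and abelian `G` this is the statement that
`ι` swaps the isotypic lines `N_χ ↔ N_χ̄` with `χ̄ ≠ χ` for `χ ≠ 1`.)

Use (blueprint G2-AUDIT §A5′): with `V = H⁸(X; ℝ)`, `G = Γ ≅ (ℤ/5)⁴`, `𝒦` positive definite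
(Hodge–Riemann), `tr(ι|𝒦) = dim 𝒦₊ − dim 𝒦₋ = Sign(ι|𝒦) = 0`, whence
`Sign(ι, X) = σ(H⁸(X)^Γ) = σ(X) − 624 = 6`.
-/

namespace Summit.Ventures.HodgeKum4.OrbitSpan

open Representation

variable {k G V : Type*} [Field k] [Group G] [AddCommGroup V] [Module k V]

/-- `𝒦(ρ)` is stable under every `ρ(h)`: `ρ(h)x = (ρ(h)x − x) + x`. -/
theorem coinvariantsKer_mapsTo (ρ : Representation k G V) (h : G) :
    Set.MapsTo (ρ h) (Coinvariants.ker ρ : Set V) (Coinvariants.ker ρ : Set V) := by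
  intro x hx
  have hx' : ρ h x = (ρ h x - x) + x := by abel
  rw [hx']
  exact add_mem (Coinvariants.sub_mem_ker h x) hx

/-- A linear map `ι` with `ι ∘ ρ(g) = ρ(g⁻¹) ∘ ι` for all `g` preserves `𝒦(ρ)`:
`ι(ρ(g)v − v) = ρ(g⁻¹)(ιv) − ιv`. -/
theorem coinvariantsKer_mapsTo_of_conj (ρ : Representation k G V) (ι : V →ₗ[k] V)
    (hι : ∀ g : G, ι ∘ₗ ρ g = ρ g⁻¹ ∘ₗ ι) :
    Set.MapsTo ι (Coinvariants.ker ρ : Set V) (Coinvariants.ker ρ : Set V) := by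
  intro x hx
  change x ∈ Coinvariants.ker ρ at hx
  change ι x ∈ Coinvariants.ker ρ
  unfold Coinvariants.ker at hx ⊢
  refine Submodule.span_induction (p := fun x _ => ι x ∈ _) ?_ ?_ ?_ ?_ hx
  · rintro _ ⟨⟨g, v⟩, rfl⟩
    have h := LinearMap.congr_fun (hι g) v
    simp only [LinearMap.coe_comp, Function.comp_apply] at h
    change ι (ρ g v - v) ∈ _
    rw [map_sub, h]
    exact Submodule.subset_span ⟨(g⁻¹, ι v), rfl⟩
  · simp
  · intro x y _ _ hx hy
    rw [map_add]
    exact add_mem hx hy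
  · intro a x _ hx
    rw [map_smul]
    exact Submodule.smul_mem _ a hx

/-- **`Σ_g ρ(g)` kills the augmentation submodule**: `(Σ_g ρ(g))(ρ(h)v − v) = Σ_g ρ(gh)v − Σ_g ρ(g)v = 0`. -/
theorem sum_apply_eq_zero_of_mem_coinvariantsKer [Fintype G] (ρ : Representation k G V) {x : V}
    (hx : x ∈ Coinvariants.ker ρ) : (∑ g : G, ρ g) x = 0 := by
  unfold Coinvariants.ker at hx
  refine Submodule.span_induction (p := fun x _ => (∑ g : G, ρ g) x = 0) ?_ ?_ ?_ ?_ hx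
  · rintro _ ⟨⟨h, v⟩, rfl⟩
    change (∑ g : G, ρ g) (ρ h v - v) = 0
    rw [map_sub, LinearMap.sum_apply, LinearMap.sum_apply, sub_eq_zero]
    simp_rw [← Module.End.mul_apply, ← map_mul]
    exact Fintype.sum_bijective (· * h) (Group.mulRight_bijective h) _ _ fun _ => rfl
  · simp
  · intro x y _ _ hx hy
    rw [map_add, hx, hy, add_zero]
  · intro a x _ hx
    rw [map_smul, hx, smul_zero]

section Trace

variable [Fintype G]

/-- **`tr(ι | 𝒦(ρ)) = 0` for `ι` inverting a group of odd order invertible in `k`.**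
Proof: each `ρ(h²) ∘ ι = ρ(h) ∘ ι ∘ ρ(h)⁻¹` has on `𝒦` the trace of `ι` (conjugation); squaring is a
bijection of `G`; and `Σ_h ρ(h²) ∘ ι = (Σ_g ρ(g)) ∘ ι` is zero on `𝒦`; so `|G| · tr(ι|𝒦) = 0`. -/
theorem trace_restrict_coinvariantsKer_eq_zero (hcard : ((Fintype.card G : ℕ) : k) ≠ 0)
    (hodd : (Nat.card G).Coprime 2) (ρ : Representation k G V) (ι : V →ₗ[k] V)
    (hι : ∀ g : G, ι ∘ₗ ρ g = ρ g⁻¹ ∘ₗ ι) :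
    LinearMap.trace k (Coinvariants.ker ρ)
      (ι.restrict (coinvariantsKer_mapsTo_of_conj ρ ι hι)) = 0 := by
  set K : Submodule k V := Coinvariants.ker ρ with hK
  have hιK := coinvariantsKer_mapsTo_of_conj ρ ι hι
  set ιK : K →ₗ[k] K := ι.restrict hιK with hιKdef
  -- the restricted group elements
  let A : G → (K →ₗ[k] K) := fun h => (ρ h).restrict (coinvariantsKer_mapsTo ρ h)
  have hA_mul : ∀ g h : G, A g ∘ₗ A h = A (g * h) := by
    intro g h
    apply LinearMap.ext
    intro x
    apply Subtype.ext
    simp [A, LinearMap.restrict_apply, map_mul]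
  have hA_one : A 1 = LinearMap.id := by
    apply LinearMap.ext
    intro x
    apply Subtype.ext
    simp [A, LinearMap.restrict_apply]
  -- T h := (ρ(h h) ∘ ι)|K = A h ∘ ιK ∘ A h⁻¹
  have hT : ∀ h : G, A (h * h) ∘ₗ ιK = A h ∘ₗ ιK ∘ₗ A h⁻¹ := by
    intro h
    apply LinearMap.ext
    intro x
    apply Subtype.ext
    have h1 := LinearMap.congr_fun (hι h⁻¹) (x : V)
    simp only [LinearMap.coe_comp, Function.comp_apply, inv_inv] at h1
    simp [A, ιK, LinearMap.restrict_apply, map_mul, h1]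
  -- each T h has the trace of ιK
  have htr : ∀ h : G, LinearMap.trace k K (A (h * h) ∘ₗ ιK) = LinearMap.trace k K ιK := by
    intro h
    rw [hT h, ← LinearMap.comp_assoc]
    change LinearMap.trace k K ((A h ∘ₗ ιK) * A h⁻¹) = _
    rw [LinearMap.trace_mul_comm]
    change LinearMap.trace k K (A h⁻¹ ∘ₗ (A h ∘ₗ ιK)) = _
    rw [← LinearMap.comp_assoc, hA_mul, inv_mul_cancel, hA_one, LinearMap.id_comp]
  -- squaring is a bijection of `G` (odd order)
  have hsq : Function.Bijective fun h : G => h * h := by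
    have hb := Nat.Coprime.pow_left_bijective (G := G) (n := 2) hodd
    simp only [pow_two] at hb
    exact hb
  -- sum over h: Σ_h A(h h) ∘ ιK vanishes, since Σ_g ρ(g) kills 𝒦
  have hsum0 : (∑ h : G, A (h * h) ∘ₗ ιK) = 0 := by
    apply LinearMap.ext
    intro x
    apply Subtype.ext
    rw [LinearMap.sum_apply, AddSubmonoidClass.coe_finsetSum]
    simp only [A, ιK, LinearMap.coe_comp, Function.comp_apply, LinearMap.restrict_apply,
      LinearMap.zero_apply, ZeroMemClass.coe_zero]
    rw [Fintype.sum_bijective _ hsq (fun h => ρ (h * h) (ι (x : V))) (fun g => ρ g (ι (x : V)))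
      (fun _ => rfl), ← LinearMap.sum_apply]
    exact sum_apply_eq_zero_of_mem_coinvariantsKer ρ (hιK x.2)
  -- take traces
  have h1 : (Fintype.card G : k) * LinearMap.trace k K ιK = 0 := by
    have h2 := congrArg (LinearMap.trace k K) hsum0
    rw [map_sum, map_zero] at h2
    simp_rw [htr] at h2
    rwa [Finset.sum_const, Finset.card_univ, nsmul_eq_mul] at h2
  exact (mul_eq_zero.1 h1).resolve_left hcard

end Trace

/-! ### The trace of an involution is `dim V₊ − dim V₋` -/

section Involution

variable {W : Type*} [AddCommGroup W] [Module k W]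

/-- For an involution `ι` (`ι² = 1`) over a field with `2 ≠ 0`, `½(1 + ι)` is the projection onto
the `+1`-eigenspace `ker(ι − 1)`. -/
theorem isProj_half_one_add (h2 : (2 : k) ≠ 0) (ι : W →ₗ[k] W) (hι : ι ∘ₗ ι = LinearMap.id) :
    LinearMap.IsProj (LinearMap.ker (ι - LinearMap.id)) ((2 : k)⁻¹ • (LinearMap.id + ι)) := by
  have hιι : ∀ x, ι (ι x) = x := fun x => LinearMap.congr_fun hι x
  constructor
  · intro x
    rw [LinearMap.mem_ker]
    simp only [LinearMap.smul_apply, LinearMap.add_apply, LinearMap.id_coe, id_eq,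
      LinearMap.sub_apply, map_smul, map_add, hιι]
    rw [sub_add_sub_cancel, sub_self, smul_zero]
  · intro x hx
    rw [LinearMap.mem_ker, LinearMap.sub_apply, sub_eq_zero, LinearMap.id_apply] at hx
    simp only [LinearMap.smul_apply, LinearMap.add_apply, LinearMap.id_coe, id_eq]
    rw [hx, ← two_smul k x, smul_smul, inv_mul_cancel₀ h2, one_smul]

/-- For an involution `ι` over a field with `2 ≠ 0`, `½(1 − ι)` is the projection onto the
`−1`-eigenspace `ker(ι + 1)`. -/
theorem isProj_half_one_sub (h2 : (2 : k) ≠ 0) (ι : W →ₗ[k] W) (hι : ι ∘ₗ ι = LinearMap.id) :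
    LinearMap.IsProj (LinearMap.ker (ι + LinearMap.id)) ((2 : k)⁻¹ • (LinearMap.id - ι)) := by
  have hιι : ∀ x, ι (ι x) = x := fun x => LinearMap.congr_fun hι x
  constructor
  · intro x
    rw [LinearMap.mem_ker]
    simp only [LinearMap.smul_apply, LinearMap.sub_apply, LinearMap.id_coe, id_eq,
      LinearMap.add_apply, map_smul, map_sub, hιι]
    rw [add_comm (ι x) x, sub_self, smul_zero]
  · intro x hx
    rw [LinearMap.mem_ker, LinearMap.add_apply, add_eq_zero_iff_eq_neg, LinearMap.id_apply] at hx
    simp only [LinearMap.smul_apply, LinearMap.sub_apply, LinearMap.id_coe, id_eq]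
    rw [hx, sub_neg_eq_add, ← two_smul k x, smul_smul, inv_mul_cancel₀ h2, one_smul]

/-- **The trace of an involution is `dim V₊ − dim V₋`** (`V± = ker(ι ∓ 1)`; field with `2 ≠ 0`):
`ι = ½(1+ι) − ½(1−ι)` and each half is a projection whose trace is the dimension of its range
(Mathlib `LinearMap.IsProj.trace`). -/
theorem trace_involution_eq_finrank_sub [FiniteDimensional k W] (h2 : (2 : k) ≠ 0) (ι : W →ₗ[k] W)
    (hι : ι ∘ₗ ι = LinearMap.id) :
    LinearMap.trace k W ι =
      (Module.finrank k (LinearMap.ker (ι - LinearMap.id)) : k) -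
        (Module.finrank k (LinearMap.ker (ι + LinearMap.id)) : k) := by
  have hdec : ι = (2 : k)⁻¹ • (LinearMap.id + ι) - (2 : k)⁻¹ • (LinearMap.id - ι) := by
    rw [← smul_sub, add_sub_sub_cancel, ← two_smul k ι, smul_smul, inv_mul_cancel₀ h2, one_smul]
  conv_lhs => rw [hdec]
  rw [map_sub, (isProj_half_one_add h2 ι hι).trace, (isProj_half_one_sub h2 ι hι).trace]

end Involution

/-! ### Consequence: an inverting involution has as many `+1` as `−1` directions on `𝒦` -/

section Balance

variable [Fintype G] [FiniteDimensional k V]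

/-- **Balance of eigenspaces on `𝒦`.**  Under the hypotheses of
`trace_restrict_coinvariantsKer_eq_zero` (odd-order `G`, `ι ∘ ρ(g) = ρ(g⁻¹) ∘ ι`) and `ι² = 1`, in
characteristic `0`: the `+1`- and `−1`-eigenspaces of `ι` on `𝒦(ρ)` have the same
dimension.  (For `Kum⁴`: `dim 𝒦₊ = dim 𝒦₋ = 312`; with `𝒦` definite this is `Sign(ι|𝒦) = 0`.) -/
theorem finrank_coinvariantsKer_involution_balance [CharZero k] (hodd : (Nat.card G).Coprime 2)
    (ρ : Representation k G V)
    (ι : V →ₗ[k] V) (hι : ∀ g : G, ι ∘ₗ ρ g = ρ g⁻¹ ∘ₗ ι) (hι2 : ι ∘ₗ ι = LinearMap.id) :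
    Module.finrank k (LinearMap.ker
        (ι.restrict (coinvariantsKer_mapsTo_of_conj ρ ι hι) - LinearMap.id)) =
      Module.finrank k (LinearMap.ker
        (ι.restrict (coinvariantsKer_mapsTo_of_conj ρ ι hι) + LinearMap.id)) := by
  set ιK := ι.restrict (coinvariantsKer_mapsTo_of_conj ρ ι hι) with hιK
  have hιK2 : ιK ∘ₗ ιK = LinearMap.id := by
    apply LinearMap.ext
    intro x
    apply Subtype.ext
    simp only [hιK, LinearMap.coe_comp, Function.comp_apply, LinearMap.restrict_apply,
      LinearMap.id_coe, id_eq]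
    exact LinearMap.congr_fun hι2 (x : V)
  have hcard : ((Fintype.card G : ℕ) : k) ≠ 0 := by exact_mod_cast Fintype.card_ne_zero
  have h0 := trace_restrict_coinvariantsKer_eq_zero hcard hodd ρ ι hι
  rw [trace_involution_eq_finrank_sub two_ne_zero ιK hιK2, sub_eq_zero, Nat.cast_inj] at h0
  exact h0

end Balance

end Summit.Ventures.HodgeKum4.OrbitSpan
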